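import Summits.SmoothPoincare4.SmoothPoincare4.Theorems.ConvexBisectionAcyclicBisectionExistsPageInvariance
import Summits.SmoothPoincare4.SmoothPoincare4.Theorems.ConvexBisectionAcyclicBisectionExistsPageRotationFlow
import Summits.SmoothPoincare4.SmoothPoincare4.Theorems.ConvexBisectionAcyclicBisectionExistsBeltMonodromyPages
import Literature.GroupTheory.CombinatorialGroupTheory.SignedHurwitzAction
import HarnessLib

/-!
# N1-move contract, preparations: the rigid page rotation and the transfer of the clauses
(wave 7, brick of stub `stub_M2geo` = node N1 of NF4 ▸ `node_N1_move`, line `modp-braid-orbits`, crux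
`ConvexBisection.AcyclicBisectionExists`, item stmt-SmoothPoincare4-10508; worker H7, lead c5;
registered sub-goal `helper_exists_rigidRotation`)

`node_N1_move` (G4, `N1_HurwitzMove_Design.lean` §2; the hypothesis `hmove` of the landed
`swap_of_move`, `…HurwitzMoveSwap.lean`) is the ONE ∀-statement left in N1: one handle `k₀` of a
generalised Lefschetz link on fibred data `(X₀, bX, Ψ, X, G₀, h, D)` is dragged by a signed angle `φ`
through a sector of pages containing at most one other handle `k₁`.  This file lands the ASSEMBLY
`node_N1_move_of_pieces (HC1) (HC2) (HD) (HE) : <node_N1_move verbatim>` from four pieces: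

* (c₁) `HC1` FREE SLICE MOVE and (c₂) `HC2` ACROSS-ONE-BELT SLICE MOVE — the geometric re-digging
  of the handle (Gompf–Stipsicz 1999 §8.2 read through Kas' handlebody, G4's findings (F1)–(F6)):
  output a new datum `(X', h', D', G)` whose `k₀`-th attaching circle is `R₃(1) ∘ L'`, where `L` is a
  push-off `R₁(1) ∘ K` of the old circle into the seam page of direction `d k₀ · e^{iε}` and `L'` is the
  TRANSPORT OF `L` THROUGH `Ψ` by the rigid page rotation `R` (`w ∘ R_t = e^{it} w`) by the angle
  `φ − ε`, read back on the base; the other circles and framings unchanged; the page twisting of `k₀`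
  unchanged; and the SEAM/BELT DICHOTOMY of the new presentation through `G` (old seam points keep their
  page angle, old deep belt points become seam points of angle `arg d k`, new deep belt points come from
  seam points of angle `arg d' k` or are old deep belt points of the same handle);
* (d) `HD` the ACROSS-BELT MONODROMY at the level of shadows (H4's deep-belt model `helper_N1_beltMonodromy`
  bridged by N1a): crossing exactly one belt direction `d k₁` counter-clockwise, the seam transport
  through `Ψ` changes shadows by `transvection (stdSymp ℤ g) (v k₁, s k₁)` (clockwise: `¬ s k₁`);
* (e) `HE` FREE SEAM TRANSPORT PRESERVES SHADOWS — LANDED (`helper_shadow_seamTransport_free`,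
  `…HurwitzMoveClasses.lean`, p170593); piece (a) THIN TUBES is landed too (`helper_exists_thinData`,
  `…HurwitzMoveModel.lean`) and is consumed inside (c₁)/(c₂).

This file: §1 the rigid page rotation (`exists_rigidRotation`, registered `helper_exists_rigidRotation`:
`helper_rotFlow_page` with constant profile, integrated); §2 the transfer of the seam and belt clauses
along a dichotomy (`clauses_of_dichotomy`); §3 the sub-arc after the push-off (`subarc`).  The assembly
itself is the sequel `…HurwitzMoveContract.lean`.  Everything here is proved; no `sorry`.  Reference: R. E. Gompf, A. I. Stipsicz, *4-Manifolds and Kirby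
Calculus* (1999), §8.2 [GompfStipsicz1999].
-/

noncomputable section

set_option linter.dupNamespace false

open scoped Manifold ContDiff Topology Real
open Set Function

namespace Summit.SmoothPoincare4.SmoothPoincare4.Theorems.AcyclicBisectionExists.ModpBraidOrbits

open Literature.GroupTheory.CombinatorialGroupTheory.SignedHurwitz
open Literature.Topology.FourManifolds Literature.Topology.FourManifolds.LefschetzBase
open Literature.Topology.FourManifolds.HandleAttachingMap

namespace HurwitzMoveContract

/-! ## §1 The rigid page rotation of the base -/

/-- **The rigid page rotation of `Base g`**: an ambient isotopy `R` preserving `rho` and the flat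
part, with the flow law, turning the page coordinate of EVERY point rigidly: `w (R_t x) = e^{it} w x`
(`helper_rotFlow_page` with the constant profile `1`; the linear ODE `(w ∘ R_· x)' = i · w` integrated
through `e^{-it} w (R_t x) = const`). [cite: Baykur2006, proof of Thm. 5.1, pp. 13–14] -/
theorem exists_rigidRotation (g : ℕ) : ∃ R : AmbientIsotopy (𝓡∂ 4) (Base g),
    (∀ (t : ℝ) (x : Base g), rho g (R.toFun t x).1 = rho g x.1) ∧
    (∀ (t : ℝ) (x : Base g), w g (R.toFun t x).1 = Complex.exp ((t : ℂ) * Complex.I) * w g x.1) ∧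
    (∀ (t : ℝ) (x : Base g), ‖cx (R.toFun t x).1‖ ^ 2 < 4 ↔ ‖cx x.1‖ ^ 2 < 4) ∧
    (∀ (t t' : ℝ) (x : Base g), R.toFun t (R.toFun t' x) = R.toFun (t + t') x) := by
  obtain ⟨R, θ, -, h0, hadd, hR, hρ, hflat, hder, -, -⟩ :=
    helper_rotFlow_page g (fun _ => (1 : ℝ)) contDiff_const
  refine ⟨R, fun t x => by rw [hR, hρ], fun t x => ?_, fun t x => by rw [hR]; exact hflat t x.1,
    fun t t' x => Subtype.ext (by rw [hR, hR, hR, hadd])⟩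
  have hx : rho g x.1 ≤ 3 / 10 := by
    have := x.2; simp only [mem_preimage, mem_Iic] at this; exact this.trans (by norm_num)
  -- `e^{-is} w (θ (s, x))` is constant in `s`
  have hd : ∀ s : ℝ, HasDerivAt (fun s : ℝ => Complex.exp (-((s : ℂ) * Complex.I)) * w g (θ (s, x.1))) 0 s := by
    intro s
    have h1 : HasDerivAt (fun u : ℝ => -((u : ℂ) * Complex.I)) (-Complex.I) s := by
      have h := ((hasDerivAt_ofReal' s).mul_const Complex.I).neg
      rwa [one_mul] at h
    have he := (Complex.hasDerivAt_exp (-((s : ℂ) * Complex.I))).comp s h1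
    refine (he.mul (hder x.1 hx s)).congr_deriv ?_
    simp only [Function.comp_def]
    push_cast
    ring
  have hc := is_const_of_deriv_eq_zero (fun s => (hd s).differentiableAt) (fun s => (hd s).deriv) t 0
  simp only [Complex.ofReal_zero, zero_mul, neg_zero, Complex.exp_zero, one_mul, h0] at hc
  rw [hR]
  calc w g (θ (t, x.1)) = Complex.exp ((t : ℂ) * Complex.I) *
        (Complex.exp (-((t : ℂ) * Complex.I)) * w g (θ (t, x.1))) := by
          rw [← mul_assoc, ← Complex.exp_add, add_neg_cancel, Complex.exp_zero, one_mul]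
    _ = Complex.exp ((t : ℂ) * Complex.I) * w g x.1 := by rw [hc]

/-! ## §2 Transfer of the seam and belt clauses along a dichotomy -/

section Transfer

variable {g n : ℕ} {X₀ : Type} [TopologicalSpace X₀] [ChartedSpace (EuclideanHalfSpace 4) X₀]
  (bX : BoundaryData (𝓡∂ 4) X₀ (𝓡 3)) (Ψ : bX.carrier → (bBase g).carrier)
  {X : Type} [TopologicalSpace X] [ChartedSpace (EuclideanHalfSpace 4) X]
  (G₀ : X₀ ≃ₘ⟮𝓡∂ 4, 𝓡∂ 4⟯ X)
  {h : Fin n → HandleAttachingMap 3 2 (Base g)} (D : MultiAttachmentData h (𝓡∂ 4) X) (d : Fin n → ℂ)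
  {X' : Type} [TopologicalSpace X'] [ChartedSpace (EuclideanHalfSpace 4) X']
  {h' : Fin n → HandleAttachingMap 3 2 (Base g)} (D' : MultiAttachmentData h' (𝓡∂ 4) X')
  (d' : Fin n → ℂ) (G : X ≃ₘ⟮𝓡∂ 4, 𝓡∂ 4⟯ X')

/-- **The seam and belt clauses of a re-presentation from its dichotomy.**  Old datum `(h, D)` of `X`
with directions `d` and the seam and belt clauses through `G₀`; new datum `(h', D')` of `X'` with
directions `d'` and `G : X ≅ X'`; DICHOTOMY: every new seam point `D'.jA a'` with `G⁻¹ (D'.jA a') ∈ ∂X`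
is an old seam point of the same page direction or an old deep belt point of handle `k` with
`w a' ∈ ℝ_{>0} d k`, and every new deep belt point of handle `k'` with boundary `G`-preimage is an old
seam point `D.jA a` with `w a ∈ ℝ_{>0} d' k'` or an old deep belt point of a handle `k` with `d k = d' k'`.
Then the seam and belt clauses hold for the new datum through `G₀ ≫ G`. [folklore] -/
theorem clauses_of_dichotomy
    (hseam : ∀ (y : bX.carrier) (a : ↥(coresComplement h)), G₀ (bX.incl y) = D.jA a →
      ∃ c : ℝ, 0 < c ∧ w g ((bBase g).incl (Ψ y)).1 = (c : ℂ) * w g (a : Base g).1)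
    (hbelt : ∀ (y : bX.carrier) (k : Fin n) (b : ↥(beltPiece 3 2)), G₀ (bX.incl y) = D.jB k b →
      G₀ (bX.incl y) ∉ range D.jA →
      ∃ c : ℝ, 0 < c ∧ w g ((bBase g).incl (Ψ y)).1 = (c : ℂ) * d k)
    (hO1 : ∀ a' : ↥(coresComplement h'), G.symm (D'.jA a') ∈ (𝓡∂ 4).boundary X →
      (∃ a : ↥(coresComplement h), G.symm (D'.jA a') = D.jA a ∧
        ∃ c : ℝ, 0 < c ∧ w g (a' : Base g).1 = (c : ℂ) * w g (a : Base g).1) ∨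
      (∃ (k : Fin n) (b : ↥(beltPiece 3 2)), G.symm (D'.jA a') = D.jB k b ∧
        G.symm (D'.jA a') ∉ range D.jA ∧ ∃ c : ℝ, 0 < c ∧ w g (a' : Base g).1 = (c : ℂ) * d k))
    (hO2 : ∀ (k' : Fin n) (b' : ↥(beltPiece 3 2)), D'.jB k' b' ∉ range D'.jA →
      G.symm (D'.jB k' b') ∈ (𝓡∂ 4).boundary X →
      (∃ a : ↥(coresComplement h), G.symm (D'.jB k' b') = D.jA a ∧
        ∃ c : ℝ, 0 < c ∧ w g (a : Base g).1 = (c : ℂ) * d' k') ∨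
      (∃ (k : Fin n) (b : ↥(beltPiece 3 2)), G.symm (D'.jB k' b') = D.jB k b ∧
        G.symm (D'.jB k' b') ∉ range D.jA ∧ d k = d' k')) :
    (∀ (y : bX.carrier) (a' : ↥(coresComplement h')), (G₀.trans G) (bX.incl y) = D'.jA a' →
      ∃ c : ℝ, 0 < c ∧ w g ((bBase g).incl (Ψ y)).1 = (c : ℂ) * w g (a' : Base g).1) ∧
    (∀ (y : bX.carrier) (k : Fin n) (b : ↥(beltPiece 3 2)), (G₀.trans G) (bX.incl y) = D'.jB k b →
      (G₀.trans G) (bX.incl y) ∉ range D'.jA →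
      ∃ c : ℝ, 0 < c ∧ w g ((bBase g).incl (Ψ y)).1 = (c : ℂ) * d' k) := by
  constructor
  · intro y a' hy
    rw [Diffeomorph.coe_trans, comp_apply] at hy
    have hGs : G.symm (D'.jA a') = G₀ (bX.incl y) := by rw [← hy, Diffeomorph.symm_apply_apply]
    have hb : G.symm (D'.jA a') ∈ (𝓡∂ 4).boundary X := hGs ▸ G₀_incl_mem_boundary bX G₀ y
    rcases hO1 a' hb with ⟨a, hGa, c, hc, hw⟩ | ⟨k, b, hGb, hnot, c, hc, hw⟩
    · obtain ⟨c₂, hc₂, hw₂⟩ := hseam y a (hGs ▸ hGa)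
      refine ⟨c₂ / c, div_pos hc₂ hc, ?_⟩
      have hc' : (c : ℂ) ≠ 0 := by exact_mod_cast hc.ne'
      rw [hw₂, hw]; push_cast; field_simp
    · obtain ⟨c₂, hc₂, hw₂⟩ := hbelt y k b (hGs ▸ hGb) (hGs ▸ hnot)
      refine ⟨c₂ / c, div_pos hc₂ hc, ?_⟩
      have hc' : (c : ℂ) ≠ 0 := by exact_mod_cast hc.ne'
      rw [hw₂, hw]; push_cast; field_simp
  · intro y k' b' hy hdeep
    rw [Diffeomorph.coe_trans, comp_apply] at hy hdeep
    have hGs : G.symm (D'.jB k' b') = G₀ (bX.incl y) := by rw [← hy, Diffeomorph.symm_apply_apply]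
    have hb : G.symm (D'.jB k' b') ∈ (𝓡∂ 4).boundary X := hGs ▸ G₀_incl_mem_boundary bX G₀ y
    rcases hO2 k' b' (hy ▸ hdeep) hb with ⟨a, hGa, c, hc, hw⟩ | ⟨k, b, hGb, hnot, hdk⟩
    · obtain ⟨c₂, hc₂, hw₂⟩ := hseam y a (hGs ▸ hGa)
      exact ⟨c₂ * c, mul_pos hc₂ hc, by rw [hw₂, hw]; push_cast; ring⟩
    · obtain ⟨c₂, hc₂, hw₂⟩ := hbelt y k b (hGs ▸ hGb) (hGs ▸ hnot)
      exact ⟨c₂, hc₂, by rw [hw₂, hdk]⟩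

end Transfer

/-! ## §3 Angle bookkeeping -/

/-- **The sub-arc after the push-off**: for `0 < ε/φ < 1` and `t ∈ [0, 1]` the direction
`d₀ e^{iε} e^{it(φ − ε)}` is `d₀ e^{it'' φ}` with `t'' ∈ [ε/φ, 1] ⊆ [0, 1]`, and it is not `d₀` when
`|φ| < 2π`. [folklore] -/
theorem subarc {d₀ : ℂ} {φ ε t : ℝ} (hφ0 : φ ≠ 0) (hφ : |φ| < 2 * π) (hε0 : 0 < ε / φ) (hε1 : ε / φ < 1)
    (ht : t ∈ Icc (0 : ℝ) 1) :
    (∃ t'' ∈ Icc (0 : ℝ) 1, d₀ * Complex.exp ((ε : ℂ) * Complex.I) *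
        Complex.exp ((((t * (φ - ε)) : ℝ) : ℂ) * Complex.I) =
      d₀ * Complex.exp ((((t'' * φ) : ℝ) : ℂ) * Complex.I)) ∧
    (‖d₀‖ = 1 → d₀ * Complex.exp ((ε : ℂ) * Complex.I) *
        Complex.exp ((((t * (φ - ε)) : ℝ) : ℂ) * Complex.I) ≠ d₀) := by
  have e1 : d₀ * Complex.exp ((ε : ℂ) * Complex.I) * Complex.exp ((((t * (φ - ε)) : ℝ) : ℂ) * Complex.I) =
      d₀ * Complex.exp ((((ε + t * (φ - ε)) : ℝ) : ℂ) * Complex.I) := by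
    rw [mul_assoc, ← Complex.exp_add]; push_cast; ring_nf
  have hq : ε / φ + t * (1 - ε / φ) ∈ Icc (0 : ℝ) 1 := by
    constructor <;> nlinarith [ht.1, ht.2]
  have e2 : ε + t * (φ - ε) = (ε / φ + t * (1 - ε / φ)) * φ := by field_simp
  refine ⟨⟨ε / φ + t * (1 - ε / φ), hq, by rw [e1, e2]⟩, fun hd hh => ?_⟩
  rw [e1] at hh
  have hd0 : d₀ ≠ 0 := by rintro rfl; simp at hd
  have h1 : Complex.exp ((((ε + t * (φ - ε)) : ℝ) : ℂ) * Complex.I) = 1 := by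
    have := mul_left_cancel₀ hd0 (hh.trans (mul_one d₀).symm); exact this
  refine exp_ofReal_mul_I_ne_one ?_ ?_ h1
  · rw [e2]; exact mul_ne_zero (by nlinarith [ht.1, ht.2]) hφ0
  · -- `|ε + t (φ − ε)| ≤ |φ|`
    rw [e2, abs_mul]
    calc |ε / φ + t * (1 - ε / φ)| * |φ| ≤ 1 * |φ| := by
          refine mul_le_mul_of_nonneg_right ?_ (abs_nonneg _)
          rw [abs_le]; constructor <;> nlinarith [hq.1, hq.2]
      _ < 2 * π := by rw [one_mul]; exact hφ

end HurwitzMoveContract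

open HurwitzMoveContract

/-! ## §4 The registered form of §1 -/

/-- **Sub-goal `helper_exists_rigidRotation`** (fully qualified): the rigid page rotation of the base,
see `exists_rigidRotation`. [cite: Baykur2006, proof of Thm. 5.1, pp. 13–14] -/
theorem helper_exists_rigidRotation : ∀ (g : ℕ), ∃ R : Literature.Topology.FourManifolds.AmbientIsotopy (𝓡∂ 4) (Literature.Topology.FourManifolds.LefschetzBase.Base g), (∀ (t : ℝ) (x : Literature.Topology.FourManifolds.LefschetzBase.Base g), Literature.Topology.FourManifolds.LefschetzBase.rho g (R.toFun t x).1 = Literature.Topology.FourManifolds.LefschetzBase.rho g x.1) ∧ (∀ (t : ℝ) (x : Literature.Topology.FourManifolds.LefschetzBase.Base g), Literature.Topology.FourManifolds.LefschetzBase.w g (R.toFun t x).1 = Complex.exp ((t : ℂ) * Complex.I) * Literature.Topology.FourManifolds.LefschetzBase.w g x.1) ∧ (∀ (t : ℝ) (x : Literature.Topology.FourManifolds.LefschetzBase.Base g), ‖Literature.Topology.FourManifolds.LefschetzBase.cx (R.toFun t x).1‖ ^ 2 < 4 ↔ ‖Literature.Topology.FourManifolds.LefschetzBase.cx x.1‖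 ^ 2 < 4) ∧ (∀ (t t' : ℝ) (x : Literature.Topology.FourManifolds.LefschetzBase.Base g), R.toFun t (R.toFun t' x) = R.toFun (t + t') x) :=
  exists_rigidRotation

end Summit.SmoothPoincare4.SmoothPoincare4.Theorems.AcyclicBisectionExists.ModpBraidOrbits

end
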